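import Summits.QuantumFields.BalabanUV.Beta.EriceFlowEnclosureB12AsPrintedHistoryContagionShiftFlowZeroLambda
import Summits.QuantumFields.BalabanUV.Beta.EriceFlowEnclosureB12AsPrintedHistoryContagionShiftFlowPicardEnd

/-!
# Beta / EriceFlowEnclosureB12AsPrintedHistoryContagionShiftFlowZeroEnd — ASYMPTOTIC FREEDOM IS CONTAGIOUS, part 36 (the END at the zero history): ON THE AS-PRINTED CARRIER THE
# LIMIT β-FUNCTIONAL HAS ONE VALUE AT THE ZERO HISTORY, THE CONTINUUM β-VALUES CONVERGE TO IT, THE CONTINUUM RUNNING COUPLING OBEYS THE ONE-LOOP LAW AND THE UNIVERSAL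
# CLOCK, AND TWO CONTINUUM TRAJECTORIES HAVE A RELATIVE Λ-PARAMETER SHIFTED BY β₀ PER RENORMALIZATION STEP.  Parts 32–35 read on the carrier of [I] Theorem 2.  §57 (NO
# Theorem 2): NE4 ALONE — `ScaleShiftRate c θ γ_u β`, `HistLipschitz Λ γ_u β` with `FadingMemory C θ Λ` (θ < 1) — gives the stationary limit functional `betaInf β` (node
# U2 ∕ NE4 P1's `T4BetaStationary`) EXACTLY ONE value β₀ at the zero history: `|betaInf β u − β₀| ≤ C·Σ_j θ^j u_j` on ]0, γ_u]^ℕ (**`existsUnique_valueAtZero_of_NE4`**), and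
# the lattice β-functions at deep scales on small constant histories are within `cθ^k∕(1 − θ) + C a∕(1 − θ)` of it (**`abs_beta_const_sub_valueAtZero_le`**) — β₀ is the
# «zero-coupling, infinite-scale» value of the whole family.  §58: add `Theorem2Statement S hL` (a HYPOTHESIS) + `hrg` ⟹ **β₀ > 0** and, for every torus exponent m, below one
# threshold g₂₂: EVERY family `rows` of Theorem-2-type rows pinned at g obeys **`|1∕gstar(m′)² − 1∕g² − m′·β₀| ≤ (8C∕((1 − θ)b))·√(1∕(2g)² + bm′∕4)`**, the clock
# **`m′·gstar(m′)² → 1∕β₀`**, and the continuum β-values CONVERGE: **`bstar rows m′ → β₀`** (**`oneLoop_of_typedTheorem2`**) — (0.20)'s continuum β-values have ONE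
# ultraviolet limit, the value of the limit functional at the zero history, the same for every row family and every renormalized coupling.  §59: two families pinned at
# `g ≤ g′ ≤ g₂₃` have a RELATIVE Λ-PARAMETER `1∕gstar(n)² − 1∕gstar′(n)² → Θ ∈ [(2∕3)Δ₀, (4∕3)Δ₀]` (**`relativeLambda_of_typedTheorem2`**), and against a reference pin the
# Λ-function of part 35 labels the continuum trajectories by [0, ∞[ with THE ABEL EQUATION `Λ(gstar rows k) = Λ(g) + k·β₀` along every family (**`lambdaFunction_of_typedTheorem2`**).
# (β-flow team, prover 1, unit `b2b-balaban-beta-bflow-p1`, gen 39; ROW AP-I·Uc × NODE U2 × ROW Λ — the carrier END at the zero history)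

HONEST FRAMING (page 1 of everything the β sub-cell writes): discharging `BetaPertH` makes Bałaban's UV stability UNCONDITIONAL — a
real constructive-QFT result; it is NOT the continuum limit and NOT the Clay problem.  HONEST DEPENDENCY (cell reorg 2026-08-19,
verbatim): «continuum YM on T⁴ ⇐ BetaPertH ∧ nine spine estimates (0/9 proved); BetaPertH ⇐ (D1) ∧ (D4) ∧ CAP+tail; G-an2-4 gates
asym, D1 and NE2/3/4.»  THIS MODULE DISCHARGES NOTHING: it is BOOKKEEPING BY NAME (parts 32–35, part 15's `reference_of_typedTheorem2`, part 6's
`continuumCoupling_bigBox_of_typedTheorem2`, part 11's `flow_threshold_exists`, part 10's `invSq_lower_of_reference_flow`, node U2's `memoryProfile_betaInf ∕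
abs_beta_sub_betaInf_padHist_le`) over node U2's HYPOTHESIS SHAPES on an abstract `S : Setting` ∕ `β : HBeta`.  `Theorem2Statement S hL` ([I] THEOREM 2 p. 259, STATED WITHOUT
PROOF; [Balaban1989LargeFieldII] p. 355), `hrg` ((0.20) p. 256), NE4 `ScaleShiftRate` (GAPS G-t4-U2-1, p. 298), `HistLipschitz` ∕ `FadingMemory` (GAPS G-t4-U2-2) are HYPOTHESES —
none asserted for Bałaban's actual β; «continuum running coupling ∕ β-value» = the K → ∞ limits of the effective couplings of (0.20) and their increments at fixed physical scale
(`T4ContinuumCoupling.gstar ∕ bstar`), NOT the continuum limit of the measures.  Whether β₀ here equals the printed one-loop coefficient (Erice (3.73)∕(3.75) p. 250; [I] (0.19)) is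
NOT PRINTED for the functional with memory ([I] p. 298) and NOT claimed.  [I] = T. Bałaban, Commun. Math. Phys. **109** (1987) 249–301 [Balaban1987RG1].

WHAT THIS FILE PROVES (0 sorry, 0 def): §57 **`existsUnique_valueAtZero_of_NE4`**, **`abs_beta_const_sub_valueAtZero_le`**; §58 `package_threshold_exists`,
**`oneLoop_of_typedTheorem2`**; §59 **`relativeLambda_of_typedTheorem2`**, **`lambdaFunction_of_typedTheorem2`**.  NOT CLAIMED: Theorem 2; the value of β₀; a two-loop law;
anything about Bałaban's β; `BetaPertH`; the continuum limit of the measures; Clay.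
-/

namespace Summit.QuantumFields.BalabanUV.Beta.EriceFlowEnclosureB12AsPrintedHistoryContagionShiftFlowZeroEnd

open Finset Filter Topology Set
open Literature.MathematicalPhysics.QuantumFieldTheory.Balaban1983to89
open Literature.MathematicalPhysics.QuantumFieldTheory.Balaban1983to89.B12BetaAsPrinted
open Literature.MathematicalPhysics.QuantumFieldTheory.Balaban1983to89.FlowStep (RGEqH HBeta)
open Literature.MathematicalPhysics.QuantumFieldTheory.Balaban1983to89.T4CouplingMatching (HistLipschitz FadingMemory ScaleShiftRate sprof)
open Literature.MathematicalPhysics.QuantumFieldTheory.Balaban1983to89.T4ContinuumCoupling (gstar bstar)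
open Literature.MathematicalPhysics.QuantumFieldTheory.Balaban1983to89.T4BetaStationary (SeqBox MemoryProfile betaInf memoryProfile_betaInf revHist
  abs_beta_revHist_sub_betaInf_le)
open Literature.MathematicalPhysics.QuantumFieldTheory.Balaban1983to89.T4BetaFlowWellPosed (MemFlow solution)
open Summit.QuantumFields.BalabanUV.Beta.EriceFlowEnclosureB12AsPrintedHistoryContagionShiftEnd (continuumCoupling_bigBox_of_typedTheorem2)
open Summit.QuantumFields.BalabanUV.Beta.EriceFlowEnclosureB12AsPrintedHistoryContagionShiftFlow (invSq_lower_of_reference_flow)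
open Summit.QuantumFields.BalabanUV.Beta.EriceFlowEnclosureB12AsPrintedHistoryContagionShiftFlowEnd (flow_threshold_exists)
open Summit.QuantumFields.BalabanUV.Beta.EriceFlowEnclosureB12AsPrintedHistoryContagionShiftFlowPicardEnd (reference_of_typedTheorem2)
open Summit.QuantumFields.BalabanUV.Beta.EriceFlowEnclosureB12AsPrintedHistoryContagionShiftFlowZero (existsUnique_valueAtZero exists_valueAtZero
  abs_sub_valueAtZero_le rate_le_valueAtZero)
open Summit.QuantumFields.BalabanUV.Beta.EriceFlowEnclosureB12AsPrintedHistoryContagionShiftFlowZeroClock (abs_invSq_sub_oneLoop_le_of_reference_flow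
  tendsto_mul_sq_of_reference_flow tendsto_invSq_shift_sub)
open Summit.QuantumFields.BalabanUV.Beta.EriceFlowEnclosureB12AsPrintedHistoryContagionShiftFlowZeroOffset (exists_relativeLambda)
open Summit.QuantumFields.BalabanUV.Beta.EriceFlowEnclosureB12AsPrintedHistoryContagionShiftFlowZeroLambda (relativeLambda_exists)

noncomputable section

/-! ## §57 NE4 alone: the limit functional has one value at the zero history -/

/-- **THE LIMIT β-FUNCTIONAL OF AN NE4 FAMILY HAS EXACTLY ONE VALUE AT THE ZERO HISTORY.**  `ScaleShiftRate c θ γ_u β`, `HistLipschitz Λ γ_u β` with `FadingMemory C θ Λ`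
(0 ≤ θ < 1, C ≥ 0, γ_u > 0) — NO Theorem 2, NO runs.  THEN there is exactly one β₀ with **`|betaInf β u − β₀| ≤ C·Σ_j θ^j u_j`** for every u ∈ ]0, γ_u]^ℕ (node U2's
`memoryProfile_betaInf` + part 32's `existsUnique_valueAtZero`). [cite: Balaban1987RG1, (0.20) p.256 and §5 p.298] -/
theorem existsUnique_valueAtZero_of_NE4 {β : HBeta} {γu θ C c : ℝ} {Λ : ℕ → ℕ → ℝ} (hγu : 0 < γu)
    (hS : ScaleShiftRate c θ γu β) (hL' : HistLipschitz Λ γu β) (hΛ : FadingMemory C θ Λ) (hθ0 : 0 ≤ θ) (hθ1 : θ < 1) (hC : 0 ≤ C) :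
    ∃! β₀ : ℝ, ∀ u : ℕ → ℝ, SeqBox γu u → |betaInf β u - β₀| ≤ C * ∑' j, θ ^ j * u j :=
  existsUnique_valueAtZero (memoryProfile_betaInf hS hL' hΛ hθ0 hθ1) hC hθ0 hθ1 hγu

/-- **THE LATTICE β-FUNCTIONS AT DEEP SCALES ON SMALL CONSTANT HISTORIES ARE CLOSE TO β₀.**  Under NE4 and with β₀ the value of `betaInf β` at the zero history, for every scale k
and every constant history `a ∈ ]0, γ_u]`: **`|β k (a, …, a) − β₀| ≤ cθ^k∕(1 − θ) + C a∕(1 − θ)`** (node U2's `abs_beta_revHist_sub_betaInf_le` + part 32's small-history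
modulus; only `ScaleShiftRate` and the letter `h0` are used) — β₀ is the zero-coupling, infinite-scale value of the whole history-dependent family. [cite: Balaban1987RG1, (0.20) p.256 and §5 p.298] -/
theorem abs_beta_const_sub_valueAtZero_le {β : HBeta} {γu θ C c β₀ a : ℝ}
    (hS : ScaleShiftRate c θ γu β) (hθ0 : 0 ≤ θ) (hθ1 : θ < 1) (hC : 0 ≤ C)
    (h0 : ∀ u : ℕ → ℝ, SeqBox γu u → |betaInf β u - β₀| ≤ C * ∑' j, θ ^ j * u j) (ha : 0 < a) (haγ : a ≤ γu) (k : ℕ) :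
    |β k (revHist (fun _ : ℕ => a) k) - β₀| ≤ c * θ ^ k / (1 - θ) + C * a / (1 - θ) := by
  have hbox : SeqBox γu (fun _ : ℕ => a) := fun _ => ⟨ha, haγ⟩
  have h1 := abs_beta_revHist_sub_betaInf_le hS hθ1 hbox k
  have h2 := abs_sub_valueAtZero_le (a := a) hC hθ0 hθ1 h0 hbox (fun _ => le_rfl)
  calc |β k (revHist (fun _ : ℕ => a) k) - β₀|
      = |(β k (revHist (fun _ : ℕ => a) k) - betaInf β (fun _ => a)) + (betaInf β (fun _ => a) - β₀)| := by ring_nf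
    _ ≤ |β k (revHist (fun _ : ℕ => a) k) - betaInf β (fun _ => a)| + |betaInf β (fun _ => a) - β₀| := abs_add_le _ _
    _ ≤ _ := add_le_add h1 h2

/-! ## §58 Theorem 2 AS TYPED: positivity of β₀, the one-loop law, the clock, convergence of the continuum β-values -/

variable {S : Setting}

/-- Part 14's smallness package `4Ce ≤ b(1 − θ)`, `e²·Q ≤ 3∕4`, `64Ce³ ≤ (1 − θ)²`, `C(8e³ + 16e∕b) ≤ (1 − θ)∕4` holds below one positive threshold (part 11's
`flow_threshold_exists` + part 15's construction for the fourth member). [folklore] -/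
theorem package_threshold_exists {C θ b : ℝ} (Q : ℝ) (hC : 0 ≤ C) (hθ1 : θ < 1) (hb : 0 < b) :
    ∃ e₀ : ℝ, 0 < e₀ ∧ ∀ e : ℝ, 0 < e → e ≤ e₀ →
      4 * C * e ≤ b * (1 - θ) ∧ e ^ 2 * Q ≤ 3 / 4 ∧ 64 * C * e ^ 3 ≤ (1 - θ) ^ 2 ∧ C * (8 * e ^ 3 + 16 * e / b) ≤ (1 - θ) / 4 := by
  have h1θ : 0 < 1 - θ := by linarith
  obtain ⟨e₀, he₀, hthr⟩ := flow_threshold_exists Q hC hθ1 hb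
  set e₁ : ℝ := min 1 ((1 - θ) / (4 * (C * (8 + 16 / b)) + 1)) with he₁
  have he₁0 : 0 < e₁ := lt_min one_pos (by positivity)
  refine ⟨min e₀ e₁, lt_min he₀ he₁0, fun e he hle => ?_⟩
  obtain ⟨h1, h2, h4⟩ := hthr e he (hle.trans (min_le_left _ _))
  refine ⟨h1, h2, h4, ?_⟩
  have hle1 : e ≤ 1 := hle.trans ((min_le_right _ _).trans (min_le_left _ _))
  have hle' : e ≤ (1 - θ) / (4 * (C * (8 + 16 / b)) + 1) := hle.trans ((min_le_right _ _).trans (min_le_right _ _))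
  rw [le_div_iff₀ (by positivity)] at hle'
  have he3 : e ^ 3 ≤ e := by nlinarith [mul_le_mul hle1 hle1 he.le zero_le_one]
  have hK : 0 ≤ C * (8 + 16 / b) := by positivity
  calc C * (8 * e ^ 3 + 16 * e / b) ≤ C * (8 * e + 16 * e / b) := by gcongr
    _ = e * (C * (8 + 16 / b)) := by ring
    _ ≤ (1 - θ) / 4 := by nlinarith

/-- **THE ONE-LOOP LAW, THE CLOCK AND THE CONVERGENCE OF THE CONTINUUM β-VALUES — FROM THEOREM 2 AS TYPED.**  `Theorem2Statement S hL` (a HYPOTHESIS), `hrg` on ]0, γ_u], NE4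
`ScaleShiftRate c θ γ_u S.β` (c ≥ 0), `HistLipschitz Λ γ_u S.β` with `FadingMemory C θ Λ` (0 < θ < 1, C ≥ 0; γ_u ARBITRARY) ⟹ there are **β₀ > 0** — THE value of `betaInf S.β` at
the zero history, `|betaInf S.β u − β₀| ≤ C·Σ θ^j u_j` on the box — and b ∈ ]0, β₀], and for every torus exponent m a threshold g₂₂ > 0, such that for EVERY family `rows` of
Theorem-2-type rows in ]0, γ_u] pinned at g ≤ g₂₂: (i) THE ONE-LOOP LAW **`|1∕gstar rows m′² − 1∕g² − m′·β₀| ≤ (8C∕((1 − θ)b))·√(1∕(2g)² + (b∕4)m′)`** at every physical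
scale m′; (ii) THE CLOCK **`m′·(gstar rows m′)² → 1∕β₀`**; (iii) **`bstar rows m′ → β₀`** — the continuum β-values of (0.20) CONVERGE in the ultraviolet to ONE number,
family- and coupling-independent; (iv) `1∕gstar rows (n+k)² − 1∕gstar rows n² → k·β₀` for every k. [cite: Balaban1987RG1, Thm 2 (0.31) p.259 with (0.20) p.256 and §5 p.298] -/
theorem oneLoop_of_typedTheorem2 {hL : Odd S.L ∧ 1 < S.L} (h : Theorem2Statement S hL)
    {γu θ C c : ℝ} {Λ : ℕ → ℕ → ℝ} (hγu : 0 < γu)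
    (hrg : ∀ P : B12.RunParams, Step.InInterval γu P.K (S.cpl P) → RGEqH P.K S.β (S.cpl P))
    (hS : ScaleShiftRate c θ γu S.β) (hL' : HistLipschitz Λ γu S.β) (hΛ : FadingMemory C θ Λ)
    (hθ0 : 0 < θ) (hθ1 : θ < 1) (hC : 0 ≤ C) (hc : 0 ≤ c) (m : ℕ) :
    ∃ β₀ b g₂₂ : ℝ, 0 < b ∧ b ≤ β₀ ∧ 0 < g₂₂ ∧
      (∀ u : ℕ → ℝ, SeqBox γu u → |betaInf S.β u - β₀| ≤ C * ∑' j, θ ^ j * u j) ∧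
      ∀ (g : ℝ) (rows : ℕ → ℕ → ℝ), 0 < g → g ≤ g₂₂ →
        (∀ K, ∃ (m' : ℕ) (g₀ : ℝ), rows K = S.cpl ⟨K, m', g₀⟩) → (∀ K, Step.InInterval γu K (rows K)) → (∀ K, rows K K = g) →
        (∀ m' : ℕ, |1 / (gstar rows m') ^ 2 - 1 / g ^ 2 - (m' : ℝ) * β₀| ≤ 8 * C / ((1 - θ) * b) * sprof (2 * g) (b / 4) m') ∧
        Tendsto (fun m' : ℕ => (m' : ℝ) * (gstar rows m') ^ 2) atTop (𝓝 (1 / β₀)) ∧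
        Tendsto (fun m' : ℕ => bstar rows m') atTop (𝓝 β₀) ∧
        ∀ k : ℕ, Tendsto (fun n : ℕ => 1 / (gstar rows (n + k)) ^ 2 - 1 / (gstar rows n) ^ 2) atTop (𝓝 ((k : ℝ) * β₀)) := by
  have h1θ : 0 < 1 - θ := by linarith
  have hB := memoryProfile_betaInf hS hL' hΛ hθ0.le hθ1
  obtain ⟨β₀, h0⟩ := exists_valueAtZero hB hC hθ0.le hθ1 hγu
  obtain ⟨gr, b, g₂, -, t, hgr, hb, hg₂, -, htbox, htflow, hprof, hmem, -⟩ :=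
    reference_of_typedTheorem2 h hγu hrg hS hL' hΛ hθ0 hθ1 hC hc m
  obtain ⟨g₂', b₂, b₂', hg₂', -, -, hall⟩ := continuumCoupling_bigBox_of_typedTheorem2 h hγu hrg hS hL' hΛ hθ0 hθ1 hC hc m
  have h2gr : 0 < 2 * gr := by positivity
  have hbβ : b ≤ β₀ := rate_le_valueAtZero hC hθ0.le hθ1 hb h2gr h0 htbox htflow hprof
  obtain ⟨e₀, he₀, hthr⟩ := flow_threshold_exists (1 / gr ^ 2 + C * γu / (1 - θ) ^ 2 + (2 * C / ((1 - θ) * b)) ^ 2) hC hθ1 hb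
  refine ⟨β₀, b, min e₀ (min g₂ g₂'), hb, hbβ, lt_min he₀ (lt_min hg₂ hg₂'), h0, fun g rows hg hle hrow hI hpin => ?_⟩
  obtain ⟨hs1, hs2, -⟩ := hthr g hg (hle.trans (min_le_left _ _))
  have hle2 : g ≤ g₂ := hle.trans ((min_le_right _ _).trans (min_le_left _ _))
  have hle2' : g ≤ g₂' := hle.trans ((min_le_right _ _).trans (min_le_right _ _))
  obtain ⟨hbox, hflow⟩ := hmem rows g hrow hI hpin hle2
  obtain ⟨-, -, -, -, hbstar, -⟩ := hall rows g hrow hI hpin hle2'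
  -- the continuum trajectory carries the profile (2g, b∕4) by part 10's contagion
  have hprofg : ∀ m' : ℕ, 1 / (2 * g) ^ 2 + b / 4 * (m' : ℝ) ≤ 1 / (gstar rows m') ^ 2 := fun m' => by
    have := invSq_lower_of_reference_flow hB hC hθ0.le hθ1 hb h2gr htbox htflow hprof hbox hflow hs1 hs2 m'
    rwa [show (1 : ℝ) / (2 * g) ^ 2 = 1 / (4 * g ^ 2) by ring]
  have hshift := fun k => tendsto_invSq_shift_sub hC hθ0.le hθ1 (by positivity : 0 < b / 4) (by positivity : 0 < 2 * g) h0 hbox hflow hprofg k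
  refine ⟨fun m' => abs_invSq_sub_oneLoop_le_of_reference_flow hB hC hθ0.le hθ1 hb h2gr h0 htbox htflow hprof hbox hflow hs1 hs2 m',
    tendsto_mul_sq_of_reference_flow hB hC hθ0.le hθ1 hb h2gr h0 htbox htflow hprof hbox hflow hs1 hs2, ?_, hshift⟩
  -- the continuum β-value at scale m′ is the chart increment over one scale
  have h1 := hshift 1
  simp only [Nat.cast_one, one_mul] at h1
  exact h1.congr fun n => by rw [hbstar n]; ring

/-! ## §59 Theorem 2 AS TYPED: the relative Λ-parameter of two continuum trajectories, and the Λ-function with its Abel equation -/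

/-- **TWO CONTINUUM TRAJECTORIES HAVE A RELATIVE Λ-PARAMETER — FROM THEOREM 2 AS TYPED.**  Under the data of `oneLoop_of_typedTheorem2`, for every torus exponent m there is
g₂₃ > 0 such that for all renormalized couplings `0 < g ≤ g′ ≤ g₂₃` and all families `rows`, `rows′` of Theorem-2-type rows in ]0, γ_u] pinned at g, g′:
**`1∕gstar rows n² − 1∕gstar rows′ n² → Θ`** with **`(2∕3)(1∕g² − 1∕g′²) ≤ Θ ≤ (4∕3)(1∕g² − 1∕g′²)`** — the deep-ultraviolet chart offset of the two continuum running
couplings of [I] Theorem 2's «g₀(ε, g)», «g₀(ε, g′)» exists and is bi-Lipschitz in 1∕g². [cite: Balaban1987RG1, Thm 2 (0.31) p.259 with (0.20) p.256 and §5 p.298] -/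
theorem relativeLambda_of_typedTheorem2 {hL : Odd S.L ∧ 1 < S.L} (h : Theorem2Statement S hL)
    {γu θ C c : ℝ} {Λ : ℕ → ℕ → ℝ} (hγu : 0 < γu)
    (hrg : ∀ P : B12.RunParams, Step.InInterval γu P.K (S.cpl P) → RGEqH P.K S.β (S.cpl P))
    (hS : ScaleShiftRate c θ γu S.β) (hL' : HistLipschitz Λ γu S.β) (hΛ : FadingMemory C θ Λ)
    (hθ0 : 0 < θ) (hθ1 : θ < 1) (hC : 0 ≤ C) (hc : 0 ≤ c) (m : ℕ) :
    ∃ g₂₃ : ℝ, 0 < g₂₃ ∧ ∀ (g g' : ℝ) (rows rows' : ℕ → ℕ → ℝ), 0 < g → g ≤ g' → g' ≤ g₂₃ →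
      (∀ K, ∃ (m' : ℕ) (g₀ : ℝ), rows K = S.cpl ⟨K, m', g₀⟩) → (∀ K, Step.InInterval γu K (rows K)) → (∀ K, rows K K = g) →
      (∀ K, ∃ (m' : ℕ) (g₀ : ℝ), rows' K = S.cpl ⟨K, m', g₀⟩) → (∀ K, Step.InInterval γu K (rows' K)) → (∀ K, rows' K K = g') →
      ∃ Θ : ℝ, Tendsto (fun n => 1 / (gstar rows n) ^ 2 - 1 / (gstar rows' n) ^ 2) atTop (𝓝 Θ) ∧
        2 / 3 * (1 / g ^ 2 - 1 / g' ^ 2) ≤ Θ ∧ Θ ≤ 4 / 3 * (1 / g ^ 2 - 1 / g' ^ 2) := by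
  have h1θ : 0 < 1 - θ := by linarith
  have hB := memoryProfile_betaInf hS hL' hΛ hθ0.le hθ1
  obtain ⟨gr, b, g₂, -, t, hgr, hb, hg₂, -, htbox, htflow, hprof, hmem, -⟩ :=
    reference_of_typedTheorem2 h hγu hrg hS hL' hΛ hθ0 hθ1 hC hc m
  have h2gr : 0 < 2 * gr := by positivity
  obtain ⟨e₀, he₀, hthr⟩ := package_threshold_exists (1 / gr ^ 2 + C * γu / (1 - θ) ^ 2 + (2 * C / ((1 - θ) * b)) ^ 2) hC hθ1 hb
  refine ⟨min e₀ (min g₂ (γu / 2)), lt_min he₀ (lt_min hg₂ (by positivity)),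
    fun g g' rows rows' hg hgg' hle hrow hI hpin hrow' hI' hpin' => ?_⟩
  have hg' : 0 < g' := hg.trans_le hgg'
  obtain ⟨hs1, hs2, hs4, hs5⟩ := hthr g' hg' (hle.trans (min_le_left _ _))
  have hle2' : g' ≤ g₂ := hle.trans ((min_le_right _ _).trans (min_le_left _ _))
  have h2g' : 2 * g' ≤ γu := by linarith [hle.trans ((min_le_right _ _).trans (min_le_right _ _))]
  obtain ⟨hbox, hflow⟩ := hmem rows g hrow hI hpin (hgg'.trans hle2')
  obtain ⟨hbox', hflow'⟩ := hmem rows' g' hrow' hI' hpin' hle2'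
  obtain ⟨Θ, hΘ, hlo, hhi, -⟩ := exists_relativeLambda hB hC hθ0.le hθ1 hb h2gr htbox htflow hprof hg hgg' h2g' hs1 hs2 hs4 hs5 hbox hflow hbox' hflow'
  exact ⟨Θ, hΘ, hlo, hhi⟩

/-- **THE Λ-FUNCTION OF THE CONTINUUM TRAJECTORIES AND ITS ABEL EQUATION — FROM THEOREM 2 AS TYPED.**  Under the data of `oneLoop_of_typedTheorem2` there is β₀ > 0 (THE value
of `betaInf S.β` at the zero history) and, for every torus exponent m, a threshold g₂₄ > 0 such that for EVERY reference coupling g′ ∈ ]0, g₂₄] carrying a Theorem-2-type family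
`rows′` there is `Λ : ℝ → ℝ` with `Λ g′ = 0`, `StrictAntiOn Λ ]0, g′]`, `ContinuousOn Λ ]0, g′]`, Λ ONTO [0, ∞[ with unique pins, and for EVERY family `rows` pinned at
`g ∈ ]0, g′]`: **`1∕gstar rows n² − 1∕gstar rows′ n² → Λ g`** and THE ABEL EQUATION **`Λ (gstar rows k) = Λ g + k·β₀`** for every physical scale k — in the coordinate Λ the
renormalization group of the limit theory acts on the continuum running coupling of [I] Theorem 2's «g₀(ε, g)» by THE RIGID TRANSLATION by β₀ per scale.
[cite: Balaban1987RG1, Thm 2 (0.31) p.259 with (0.20) p.256 and §5 p.298] -/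
theorem lambdaFunction_of_typedTheorem2 {hL : Odd S.L ∧ 1 < S.L} (h : Theorem2Statement S hL)
    {γu θ C c : ℝ} {Λ : ℕ → ℕ → ℝ} (hγu : 0 < γu)
    (hrg : ∀ P : B12.RunParams, Step.InInterval γu P.K (S.cpl P) → RGEqH P.K S.β (S.cpl P))
    (hS : ScaleShiftRate c θ γu S.β) (hL' : HistLipschitz Λ γu S.β) (hΛ : FadingMemory C θ Λ)
    (hθ0 : 0 < θ) (hθ1 : θ < 1) (hC : 0 ≤ C) (hc : 0 ≤ c) (m : ℕ) :
    ∃ β₀ g₂₄ : ℝ, 0 < β₀ ∧ 0 < g₂₄ ∧ (∀ u : ℕ → ℝ, SeqBox γu u → |betaInf S.β u - β₀| ≤ C * ∑' j, θ ^ j * u j) ∧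
      ∀ (g' : ℝ) (rows' : ℕ → ℕ → ℝ), 0 < g' → g' ≤ g₂₄ →
      (∀ K, ∃ (m' : ℕ) (g₀ : ℝ), rows' K = S.cpl ⟨K, m', g₀⟩) → (∀ K, Step.InInterval γu K (rows' K)) → (∀ K, rows' K K = g') →
      ∃ Λf : ℝ → ℝ, Λf g' = 0 ∧ StrictAntiOn Λf (Ioc 0 g') ∧ ContinuousOn Λf (Ioc 0 g') ∧
        (∀ y : ℝ, 0 ≤ y → ∃! e : ℝ, e ∈ Ioc 0 g' ∧ Λf e = y) ∧
        ∀ (g : ℝ) (rows : ℕ → ℕ → ℝ), 0 < g → g ≤ g' →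
          (∀ K, ∃ (m' : ℕ) (g₀ : ℝ), rows K = S.cpl ⟨K, m', g₀⟩) → (∀ K, Step.InInterval γu K (rows K)) → (∀ K, rows K K = g) →
          Tendsto (fun n => 1 / (gstar rows n) ^ 2 - 1 / (gstar rows' n) ^ 2) atTop (𝓝 (Λf g)) ∧
          ∀ k : ℕ, Λf (gstar rows k) = Λf g + (k : ℝ) * β₀ := by
  have h1θ : 0 < 1 - θ := by linarith
  have hB := memoryProfile_betaInf hS hL' hΛ hθ0.le hθ1
  obtain ⟨β₀, h0⟩ := exists_valueAtZero hB hC hθ0.le hθ1 hγu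
  obtain ⟨gr, b, g₂, -, t, hgr, hb, hg₂, -, htbox, htflow, hprof, hmem, -⟩ :=
    reference_of_typedTheorem2 h hγu hrg hS hL' hΛ hθ0 hθ1 hC hc m
  have h2gr : 0 < 2 * gr := by positivity
  have hβ₀ : 0 < β₀ := hb.trans_le (rate_le_valueAtZero hC hθ0.le hθ1 hb h2gr h0 htbox htflow hprof)
  obtain ⟨e₀, he₀, hthr⟩ := package_threshold_exists (1 / gr ^ 2 + C * γu / (1 - θ) ^ 2 + (2 * C / ((1 - θ) * b)) ^ 2) hC hθ1 hb
  refine ⟨β₀, min e₀ (min g₂ (γu / 2)), hβ₀, lt_min he₀ (lt_min hg₂ (by positivity)), h0, fun g' rows' hg' hle hrow' hI' hpin' => ?_⟩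
  obtain ⟨hs1, hs2, hs4, hs5⟩ := hthr g' hg' (hle.trans (min_le_left _ _))
  have hle2' : g' ≤ g₂ := hle.trans ((min_le_right _ _).trans (min_le_left _ _))
  have h2g' : 2 * g' ≤ γu := by linarith [hle.trans ((min_le_right _ _).trans (min_le_right _ _))]
  obtain ⟨hbox', hflow'⟩ := hmem rows' g' hrow' hI' hpin' hle2'
  obtain ⟨Λf, hΛ0, hΛh, -, hanti, hcont, habel, hsurj⟩ :=
    relativeLambda_exists hB hC hθ0.le hθ1 hb h2gr h0 htbox htflow hprof hg' h2g' hs1 hs2 hs4 hs5 hbox' hflow'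
  refine ⟨Λf, hΛ0, hanti, hcont, hsurj, fun g rows hg hgg' hrow hI hpin => ?_⟩
  obtain ⟨hbox, hflow⟩ := hmem rows g hrow hI hpin (hgg'.trans hle2')
  exact ⟨hΛh g ⟨hg, hgg'⟩ _ hbox hflow, habel g ⟨hg, hgg'⟩ _ hbox hflow⟩

end

end Summit.QuantumFields.BalabanUV.Beta.EriceFlowEnclosureB12AsPrintedHistoryContagionShiftFlowZeroEnd
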